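import Summits.QuantumFields.GaugeBoot.ZdLoopEquation
import Summits.QuantumFields.GaugeBoot.ClassBHaarShift
import Summits.QuantumFields.GaugeBoot.TiltedBoxLimitClass
import HarnessLib

/-!
# The `SU(N)` and `U(N)` loop equations hold for every Haar-shift state on `ℤ^d`: Class B, Class T, DLR states (gauge-boot, `ℤ^d` loop equations 4/4)

HONEST FRAMING (cell `pub-gaugeboot`, page 1 of every file): the venture produces certified bounds
on lattice expectations at stated coupling, gauge group, dimension and torus size; NOT a mass gap,
NOT a continuum limit, NOT a string tension; NOT Yang–Mills-summit-bearing (barriers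
`FixedCouplingUltralocality`, `PerturbativeInvisibility`). This file proves which identities a class
of infinite-volume states satisfies exactly; nothing else is claimed.

File 4/4, the STATEMENTS OF RECORD in the `ℤ^d` vocabulary of `ClassBWords.lean` (`wordHolonomyZd`,
`Word.endpointZd`, the occurrence sets `Word.fwdOccZ` / `Word.bwdOccZ` of `LoopEquationSchema.lean`):

* **`IsHaarShiftState.loopEquation_pairForm_suN`** — for `G = SU(N)` (fundamental representation),
  EVERY real `β`, every finite measure `μ` on `LGConfig d SU(N)` satisfying the one-link Haar-shift
  identity `IsHaarShiftState (fundamentalRep (Fin N)) β μ`, every site `x ∈ ℤ^d`, axis `a` and word `w`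
  closed at `x`: the single-link loop (Schwinger–Dyson / Makeenko–Migdal) equation in the REAL PAIR
  normal form of `PeriodicLoopEquationPairForm.lean` / `TiltedBoxLimitLoopEquation.lean` holds for `μ`
  — verbatim the identity `loopEquation_pairForm_suN_of_mem_tiltedBoxLimitPoints` with the hypothesis
  "tilted limit point" replaced by the Haar-shift identity alone (no invariance, no reflection
  positivity, no limit procedure, no smallness of the word);
* **`IsHaarShiftState.loopEquation_pairForm_uN`** — the `U(N)` twin (`s = 0`: no `1/N²` and no pair
  plaquette terms);
* hence for every **Class-B state** (`ClassBState.loopEquation_pairForm_suN/uN` — the `H`-side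
  loop-equation rows of a Class-B certificate are exact for every `ω : ClassBState`, closing the item
  "Not here: the loop equations for Class-B states" of `ClassB.lean` / `ClassBWords.lean`), every
  **Class-T state** (`TiltedRP.TiltedClassState.loopEquation_pairForm_suN/uN`), and every
  **infinite-volume DLR state** `μ ∈ ymGibbsMeasures ρ β` (`loopEquation_pairForm_suN/uN_of_mem_ymGibbsMeasures`,
  via `isHaarShiftState_of_mem_ymGibbsMeasures`), in particular every torus limit point
  (`loopEquation_pairForm_suN/uN_of_mem_infiniteVolumeLimitPoints`) and every tilted limit point
  (already `TiltedBoxLimitLoopEquation.lean`, by limits; here a second route).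

So, together with Gram positivity (`sum_mul_integral_wordLoopZd_nonneg`, every probability measure)
and the RP blocks (`ClassBState.rpBlock_nonneg`, axioms), ALL constraint families a Class-B
loop-equation SDP consumes are now theorems about every Class-B state: a certificate for such an SDP
proves its bound for every `ω : ClassBState d (fundamentalRep (Fin N)) β`. Whether the physical
thermodynamic-limit states are Class B (`ThermodynamicLimitIsClassB`) remains OPEN and untouched.

Everything is `[folklore]`: the finite-`N` single-link Schwinger–Dyson equations (Anderson–Kruczenski
Nucl. Phys. B 921 (2017) §2.2; Kazakov–Zheng JHEP 03 (2025) 099 §2.3 (2.26)–(2.31); Guo–Li–Yang–Zhu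
arXiv:2502.14421 §4; rigorous on finite lattices: Cao–Park–Sheffield, Comm. AMS 5 (2025) Thm. 5.7 /
6.104; for infinite-volume `SO(N)` limits: Chatterjee, Comm. Math. Phys. 366 (2019) Thm. 8.1), here
for every one-link Gibbs (DLR) state of the infinite lattice (Georgii 2011 Def. 2.9; Seiler LNP 159 Ch. 2).
-/

noncomputable section

open MeasureTheory
open scoped Matrix
open Literature.Probability.LatticeModels (Site IsGibbsMeasure)
open Literature.MathematicalPhysics.QuantumLattice (LGConfig ZdEdge fundamentalRep unitaryFundamentalRep
  fundamentalLatticeRep unitaryFundamentalLatticeRep continuous_fundamentalRep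
  continuous_unitaryFundamentalRep ymGibbsMeasures ymSpecification infiniteVolumeLimitPoints
  mem_ymGibbsMeasures_of_mem_infiniteVolumeLimitPoints_holds)

namespace Summit.QuantumFields.GaugeBoot

variable {d N : ℕ}

/-! ## `SU(N)` -/

section SpecialUnitary

/-- **THE `SU(N)` SINGLE-LINK LOOP EQUATION IN REAL PAIR NORMAL FORM HOLDS FOR EVERY HAAR-SHIFT
STATE ON `ℤ^d`** (every `N`, every real `β`, every finite measure `μ` with the one-link Gibbs identity
of the Wilson action; `w` a word closed at `x` on `ℤ^d`, `a` the axis of the link `(x, a)`): with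
`w(C) = (1/N) Re ∫ tr ρ(hol_x C) dμ` and `d(A, B) = Re ∫ tr ρ(hol_x A) tr ρ(hol_x B) dμ / N²` written out,
`Σ_{k ∈ fwdOccZ} (d(w[0,k), w[k,n)) − w(w)/N²) − Σ_{k ∈ bwdOccZ} (d(w[0,k], w(k,n)) − w(w)/N²)`
`+ (β/(2N))·Σ_{ν ≠ a} Σ_ε (w(w·P̃) − w(w·P̃⁻¹) − (d(w, P̃) − d(w, P̃⁻¹))) = 0`. [folklore] -/
theorem IsHaarShiftState.loopEquation_pairForm_suN {β : ℝ}
    {μ : Measure (LGConfig d (Matrix.specialUnitaryGroup (Fin N) ℂ))} [IsFiniteMeasure μ]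
    (hμ : IsHaarShiftState (fundamentalRep (Fin N)) β μ) (x : Site d) (a : Fin d) (w : Word d)
    (hw : GaugeBoot.Word.endpointZd x w = x) :
    (∑ k ∈ (Finset.range w.length).filter (w.fwdOccZ a),
        ((∫ U, (fundamentalRep (Fin N) (wordHolonomyZd U x (w.take k))).trace *
              (fundamentalRep (Fin N) (wordHolonomyZd U x (w.drop k))).trace ∂μ).re / (N : ℝ) ^ 2 -
          (N : ℝ)⁻¹ * (∫ U, (fundamentalRep (Fin N) (wordHolonomyZd U x w)).trace ∂μ).re / (N : ℝ) ^ 2)) -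
      (∑ k ∈ (Finset.range w.length).filter (w.bwdOccZ a),
        ((∫ U, (fundamentalRep (Fin N) (wordHolonomyZd U x (w.take (k + 1)))).trace *
              (fundamentalRep (Fin N) (wordHolonomyZd U x (w.drop (k + 1)))).trace ∂μ).re / (N : ℝ) ^ 2 -
          (N : ℝ)⁻¹ * (∫ U, (fundamentalRep (Fin N) (wordHolonomyZd U x w)).trace ∂μ).re / (N : ℝ) ^ 2)) +
      β / (2 * N) * ∑ ν ∈ Finset.univ.erase a, ∑ ε : Bool,
        ((N : ℝ)⁻¹ * (∫ U, (fundamentalRep (Fin N) (wordHolonomyZd U x (w ++ plaqWord a ν ε))).trace ∂μ).re -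
          (N : ℝ)⁻¹ * (∫ U, (fundamentalRep (Fin N)
            (wordHolonomyZd U x (w ++ (plaqWord a ν ε).reverse))).trace ∂μ).re -
          ((∫ U, (fundamentalRep (Fin N) (wordHolonomyZd U x w)).trace *
                (fundamentalRep (Fin N) (wordHolonomyZd U x (plaqWord a ν ε))).trace ∂μ).re / (N : ℝ) ^ 2 -
            (∫ U, (fundamentalRep (Fin N) (wordHolonomyZd U x w)).trace *
                (fundamentalRep (Fin N) (wordHolonomyZd U x (plaqWord a ν ε).reverse)).trace ∂μ).re /
              (N : ℝ) ^ 2)) = 0 := by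
  have hw' : TiltedRP.Word.endpoint (TiltedRP.zdUnit d) x w = x := by rwa [TiltedRP.endpoint_zdUnit]
  have h := TiltedRP.loopEquationZd_pairForm μ (fundamentalLatticeRep N) β x a 1 w hw' fun i j =>
    TiltedRP.sdPairZd_specialUnitaryGroup N hμ x a x w _
      (by rw [Complex.ofReal_one]; exact trace_unitDir_one i j)
  simp only [one_mul, TiltedRP.wordHolonomy_zdUnit] at h
  exact h

/-- **The `SU(N)` loop equations hold for every Class-B state** (`H`-side rows of a Class-B
certificate are exact for every `ω : ClassBState`; every real `β`). [folklore] -/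
theorem ClassBState.loopEquation_pairForm_suN {β : ℝ} (ω : ClassBState d (fundamentalRep (Fin N)) β)
    (x : Site d) (a : Fin d) (w : Word d) (hw : GaugeBoot.Word.endpointZd x w = x) :
    (∑ k ∈ (Finset.range w.length).filter (w.fwdOccZ a),
        ((∫ U, (fundamentalRep (Fin N) (wordHolonomyZd U x (w.take k))).trace *
              (fundamentalRep (Fin N) (wordHolonomyZd U x (w.drop k))).trace ∂ω.μ).re / (N : ℝ) ^ 2 -
          (N : ℝ)⁻¹ * (∫ U, (fundamentalRep (Fin N) (wordHolonomyZd U x w)).trace ∂ω.μ).re / (N : ℝ) ^ 2)) -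
      (∑ k ∈ (Finset.range w.length).filter (w.bwdOccZ a),
        ((∫ U, (fundamentalRep (Fin N) (wordHolonomyZd U x (w.take (k + 1)))).trace *
              (fundamentalRep (Fin N) (wordHolonomyZd U x (w.drop (k + 1)))).trace ∂ω.μ).re / (N : ℝ) ^ 2 -
          (N : ℝ)⁻¹ * (∫ U, (fundamentalRep (Fin N) (wordHolonomyZd U x w)).trace ∂ω.μ).re / (N : ℝ) ^ 2)) +
      β / (2 * N) * ∑ ν ∈ Finset.univ.erase a, ∑ ε : Bool,
        ((N : ℝ)⁻¹ * (∫ U, (fundamentalRep (Fin N) (wordHolonomyZd U x (w ++ plaqWord a ν ε))).trace ∂ω.μ).re -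
          (N : ℝ)⁻¹ * (∫ U, (fundamentalRep (Fin N)
            (wordHolonomyZd U x (w ++ (plaqWord a ν ε).reverse))).trace ∂ω.μ).re -
          ((∫ U, (fundamentalRep (Fin N) (wordHolonomyZd U x w)).trace *
                (fundamentalRep (Fin N) (wordHolonomyZd U x (plaqWord a ν ε))).trace ∂ω.μ).re / (N : ℝ) ^ 2 -
            (∫ U, (fundamentalRep (Fin N) (wordHolonomyZd U x w)).trace *
                (fundamentalRep (Fin N) (wordHolonomyZd U x (plaqWord a ν ε).reverse)).trace ∂ω.μ).re /
              (N : ℝ) ^ 2)) = 0 := by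
  haveI := ω.isProbabilityMeasure
  exact ω.haarShift.loopEquation_pairForm_suN x a w hw

/-- **The `SU(N)` loop equations hold for every Class-T state** of every tilted plane `(i, j)`
(every real `β`). [folklore] -/
theorem TiltedRP.TiltedClassState.loopEquation_pairForm_suN {i j : Fin d} {β : ℝ}
    (ω : TiltedRP.TiltedClassState d i j (fundamentalRep (Fin N)) β)
    (x : Site d) (a : Fin d) (w : Word d) (hw : GaugeBoot.Word.endpointZd x w = x) :
    (∑ k ∈ (Finset.range w.length).filter (w.fwdOccZ a),
        ((∫ U, (fundamentalRep (Fin N) (wordHolonomyZd U x (w.take k))).trace *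
              (fundamentalRep (Fin N) (wordHolonomyZd U x (w.drop k))).trace ∂ω.μ).re / (N : ℝ) ^ 2 -
          (N : ℝ)⁻¹ * (∫ U, (fundamentalRep (Fin N) (wordHolonomyZd U x w)).trace ∂ω.μ).re / (N : ℝ) ^ 2)) -
      (∑ k ∈ (Finset.range w.length).filter (w.bwdOccZ a),
        ((∫ U, (fundamentalRep (Fin N) (wordHolonomyZd U x (w.take (k + 1)))).trace *
              (fundamentalRep (Fin N) (wordHolonomyZd U x (w.drop (k + 1)))).trace ∂ω.μ).re / (N : ℝ) ^ 2 -
          (N : ℝ)⁻¹ * (∫ U, (fundamentalRep (Fin N) (wordHolonomyZd U x w)).trace ∂ω.μ).re / (N : ℝ) ^ 2)) +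
      β / (2 * N) * ∑ ν ∈ Finset.univ.erase a, ∑ ε : Bool,
        ((N : ℝ)⁻¹ * (∫ U, (fundamentalRep (Fin N) (wordHolonomyZd U x (w ++ plaqWord a ν ε))).trace ∂ω.μ).re -
          (N : ℝ)⁻¹ * (∫ U, (fundamentalRep (Fin N)
            (wordHolonomyZd U x (w ++ (plaqWord a ν ε).reverse))).trace ∂ω.μ).re -
          ((∫ U, (fundamentalRep (Fin N) (wordHolonomyZd U x w)).trace *
                (fundamentalRep (Fin N) (wordHolonomyZd U x (plaqWord a ν ε))).trace ∂ω.μ).re / (N : ℝ) ^ 2 -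
            (∫ U, (fundamentalRep (Fin N) (wordHolonomyZd U x w)).trace *
                (fundamentalRep (Fin N) (wordHolonomyZd U x (plaqWord a ν ε).reverse)).trace ∂ω.μ).re /
              (N : ℝ) ^ 2)) = 0 := by
  haveI := ω.isProbabilityMeasure
  exact ω.haarShift.loopEquation_pairForm_suN x a w hw

/-- **The `SU(N)` loop equations hold for every infinite-volume DLR state** `μ ∈ 𝒢(β)` of lattice
Yang–Mills on `ℤ^d` (every real `β`, every `d`): DLR states are Haar-shift states
(`isHaarShiftState_of_mem_ymGibbsMeasures`). In particular for every torus limit point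
(`mem_ymGibbsMeasures_of_mem_infiniteVolumeLimitPoints_holds`) and every tilted limit point. [folklore] -/
theorem loopEquation_pairForm_suN_of_mem_ymGibbsMeasures {β : ℝ}
    {μ : Measure (LGConfig d (Matrix.specialUnitaryGroup (Fin N) ℂ))}
    (hμ : μ ∈ ymGibbsMeasures (fundamentalRep (Fin N)) β) (x : Site d) (a : Fin d) (w : Word d)
    (hw : GaugeBoot.Word.endpointZd x w = x) :
    (∑ k ∈ (Finset.range w.length).filter (w.fwdOccZ a),
        ((∫ U, (fundamentalRep (Fin N) (wordHolonomyZd U x (w.take k))).trace *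
              (fundamentalRep (Fin N) (wordHolonomyZd U x (w.drop k))).trace ∂μ).re / (N : ℝ) ^ 2 -
          (N : ℝ)⁻¹ * (∫ U, (fundamentalRep (Fin N) (wordHolonomyZd U x w)).trace ∂μ).re / (N : ℝ) ^ 2)) -
      (∑ k ∈ (Finset.range w.length).filter (w.bwdOccZ a),
        ((∫ U, (fundamentalRep (Fin N) (wordHolonomyZd U x (w.take (k + 1)))).trace *
              (fundamentalRep (Fin N) (wordHolonomyZd U x (w.drop (k + 1)))).trace ∂μ).re / (N : ℝ) ^ 2 -
          (N : ℝ)⁻¹ * (∫ U, (fundamentalRep (Fin N) (wordHolonomyZd U x w)).trace ∂μ).re / (N : ℝ) ^ 2)) +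
      β / (2 * N) * ∑ ν ∈ Finset.univ.erase a, ∑ ε : Bool,
        ((N : ℝ)⁻¹ * (∫ U, (fundamentalRep (Fin N) (wordHolonomyZd U x (w ++ plaqWord a ν ε))).trace ∂μ).re -
          (N : ℝ)⁻¹ * (∫ U, (fundamentalRep (Fin N)
            (wordHolonomyZd U x (w ++ (plaqWord a ν ε).reverse))).trace ∂μ).re -
          ((∫ U, (fundamentalRep (Fin N) (wordHolonomyZd U x w)).trace *
                (fundamentalRep (Fin N) (wordHolonomyZd U x (plaqWord a ν ε))).trace ∂μ).re / (N : ℝ) ^ 2 -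
            (∫ U, (fundamentalRep (Fin N) (wordHolonomyZd U x w)).trace *
                (fundamentalRep (Fin N) (wordHolonomyZd U x (plaqWord a ν ε).reverse)).trace ∂μ).re /
              (N : ℝ) ^ 2)) = 0 := by
  haveI : SecondCountableTopology (Matrix (Fin N) (Fin N) ℂ) :=
    inferInstanceAs (SecondCountableTopology (Fin N → Fin N → ℂ))
  haveI : SecondCountableTopology (Matrix.specialUnitaryGroup (Fin N) ℂ) :=
    Topology.IsEmbedding.subtypeVal.secondCountableTopology
  have hG : IsGibbsMeasure (ymSpecification (fundamentalRep (Fin N)) β) μ := hμ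
  haveI := hG.isProbabilityMeasure
  exact (isHaarShiftState_of_mem_ymGibbsMeasures (fundamentalRep (Fin N)) (continuous_fundamentalRep (Fin N))
    hμ).loopEquation_pairForm_suN x a w hw

/-- **The `SU(N)` loop equations hold for every infinite-volume limit point of the torus Wilson
states** (`infiniteVolumeLimitPoints`; every real `β`, every `d`) — torus limit points are DLR states
(Georgii Thm. 4.17, `mem_ymGibbsMeasures_of_mem_infiniteVolumeLimitPoints_holds`). [folklore] -/
theorem loopEquation_pairForm_suN_of_mem_infiniteVolumeLimitPoints {β : ℝ}
    {μ : Measure (LGConfig d (Matrix.specialUnitaryGroup (Fin N) ℂ))}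
    (hμ : μ ∈ infiniteVolumeLimitPoints (d := d) (fundamentalRep (Fin N)) β) (x : Site d) (a : Fin d)
    (w : Word d) (hw : GaugeBoot.Word.endpointZd x w = x) :
    (∑ k ∈ (Finset.range w.length).filter (w.fwdOccZ a),
        ((∫ U, (fundamentalRep (Fin N) (wordHolonomyZd U x (w.take k))).trace *
              (fundamentalRep (Fin N) (wordHolonomyZd U x (w.drop k))).trace ∂μ).re / (N : ℝ) ^ 2 -
          (N : ℝ)⁻¹ * (∫ U, (fundamentalRep (Fin N) (wordHolonomyZd U x w)).trace ∂μ).re / (N : ℝ) ^ 2)) -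
      (∑ k ∈ (Finset.range w.length).filter (w.bwdOccZ a),
        ((∫ U, (fundamentalRep (Fin N) (wordHolonomyZd U x (w.take (k + 1)))).trace *
              (fundamentalRep (Fin N) (wordHolonomyZd U x (w.drop (k + 1)))).trace ∂μ).re / (N : ℝ) ^ 2 -
          (N : ℝ)⁻¹ * (∫ U, (fundamentalRep (Fin N) (wordHolonomyZd U x w)).trace ∂μ).re / (N : ℝ) ^ 2)) +
      β / (2 * N) * ∑ ν ∈ Finset.univ.erase a, ∑ ε : Bool,
        ((N : ℝ)⁻¹ * (∫ U, (fundamentalRep (Fin N) (wordHolonomyZd U x (w ++ plaqWord a ν ε))).trace ∂μ).re -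
          (N : ℝ)⁻¹ * (∫ U, (fundamentalRep (Fin N)
            (wordHolonomyZd U x (w ++ (plaqWord a ν ε).reverse))).trace ∂μ).re -
          ((∫ U, (fundamentalRep (Fin N) (wordHolonomyZd U x w)).trace *
                (fundamentalRep (Fin N) (wordHolonomyZd U x (plaqWord a ν ε))).trace ∂μ).re / (N : ℝ) ^ 2 -
            (∫ U, (fundamentalRep (Fin N) (wordHolonomyZd U x w)).trace *
                (fundamentalRep (Fin N) (wordHolonomyZd U x (plaqWord a ν ε).reverse)).trace ∂μ).re /
              (N : ℝ) ^ 2)) = 0 := by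
  haveI : SecondCountableTopology (Matrix (Fin N) (Fin N) ℂ) :=
    inferInstanceAs (SecondCountableTopology (Fin N → Fin N → ℂ))
  haveI : SecondCountableTopology (Matrix.specialUnitaryGroup (Fin N) ℂ) :=
    Topology.IsEmbedding.subtypeVal.secondCountableTopology
  exact loopEquation_pairForm_suN_of_mem_ymGibbsMeasures
    (mem_ymGibbsMeasures_of_mem_infiniteVolumeLimitPoints_holds (fundamentalRep (Fin N))
      (continuous_fundamentalRep (Fin N)) hμ) x a w hw

end SpecialUnitary

/-! ## `U(N)` -/

section Unitary

/-- **THE `U(N)` SINGLE-LINK LOOP EQUATION IN REAL PAIR NORMAL FORM HOLDS FOR EVERY HAAR-SHIFT STATE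
ON `ℤ^d`** (`s = 0`: no `1/N²` terms and no pair plaquette terms; every `N`, every real `β`). [folklore] -/
theorem IsHaarShiftState.loopEquation_pairForm_uN {β : ℝ}
    {μ : Measure (LGConfig d (Matrix.unitaryGroup (Fin N) ℂ))} [IsFiniteMeasure μ]
    (hμ : IsHaarShiftState (unitaryFundamentalRep (Fin N) ℂ) β μ) (x : Site d) (a : Fin d) (w : Word d)
    (hw : GaugeBoot.Word.endpointZd x w = x) :
    (∑ k ∈ (Finset.range w.length).filter (w.fwdOccZ a),
        (∫ U, (unitaryFundamentalRep (Fin N) ℂ (wordHolonomyZd U x (w.take k))).trace *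
              (unitaryFundamentalRep (Fin N) ℂ (wordHolonomyZd U x (w.drop k))).trace ∂μ).re / (N : ℝ) ^ 2) -
      (∑ k ∈ (Finset.range w.length).filter (w.bwdOccZ a),
        (∫ U, (unitaryFundamentalRep (Fin N) ℂ (wordHolonomyZd U x (w.take (k + 1)))).trace *
              (unitaryFundamentalRep (Fin N) ℂ (wordHolonomyZd U x (w.drop (k + 1)))).trace ∂μ).re /
          (N : ℝ) ^ 2) +
      β / (2 * N) * ∑ ν ∈ Finset.univ.erase a, ∑ ε : Bool,
        ((N : ℝ)⁻¹ * (∫ U, (unitaryFundamentalRep (Fin N) ℂ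
            (wordHolonomyZd U x (w ++ plaqWord a ν ε))).trace ∂μ).re -
          (N : ℝ)⁻¹ * (∫ U, (unitaryFundamentalRep (Fin N) ℂ
            (wordHolonomyZd U x (w ++ (plaqWord a ν ε).reverse))).trace ∂μ).re) = 0 := by
  have hw' : TiltedRP.Word.endpoint (TiltedRP.zdUnit d) x w = x := by rwa [TiltedRP.endpoint_zdUnit]
  have h := TiltedRP.loopEquationZd_pairForm μ (unitaryFundamentalLatticeRep N) β x a 0 w hw' fun i j => by
    rw [Complex.ofReal_zero]; exact TiltedRP.sdPairZd_unitaryGroup N hμ x a x w _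
  simp only [zero_mul, sub_zero, TiltedRP.wordHolonomy_zdUnit] at h
  exact h

/-- **The `U(N)` loop equations hold for every Class-B state** (every real `β`). [folklore] -/
theorem ClassBState.loopEquation_pairForm_uN {β : ℝ}
    (ω : ClassBState d (unitaryFundamentalRep (Fin N) ℂ) β) (x : Site d) (a : Fin d) (w : Word d)
    (hw : GaugeBoot.Word.endpointZd x w = x) :
    (∑ k ∈ (Finset.range w.length).filter (w.fwdOccZ a),
        (∫ U, (unitaryFundamentalRep (Fin N) ℂ (wordHolonomyZd U x (w.take k))).trace *
              (unitaryFundamentalRep (Fin N) ℂ (wordHolonomyZd U x (w.drop k))).trace ∂ω.μ).re / (N : ℝ) ^ 2) -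
      (∑ k ∈ (Finset.range w.length).filter (w.bwdOccZ a),
        (∫ U, (unitaryFundamentalRep (Fin N) ℂ (wordHolonomyZd U x (w.take (k + 1)))).trace *
              (unitaryFundamentalRep (Fin N) ℂ (wordHolonomyZd U x (w.drop (k + 1)))).trace ∂ω.μ).re /
          (N : ℝ) ^ 2) +
      β / (2 * N) * ∑ ν ∈ Finset.univ.erase a, ∑ ε : Bool,
        ((N : ℝ)⁻¹ * (∫ U, (unitaryFundamentalRep (Fin N) ℂ
            (wordHolonomyZd U x (w ++ plaqWord a ν ε))).trace ∂ω.μ).re -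
          (N : ℝ)⁻¹ * (∫ U, (unitaryFundamentalRep (Fin N) ℂ
            (wordHolonomyZd U x (w ++ (plaqWord a ν ε).reverse))).trace ∂ω.μ).re) = 0 := by
  haveI := ω.isProbabilityMeasure
  exact ω.haarShift.loopEquation_pairForm_uN x a w hw

/-- **The `U(N)` loop equations hold for every Class-T state** of every tilted plane `(i, j)`
(every real `β`). [folklore] -/
theorem TiltedRP.TiltedClassState.loopEquation_pairForm_uN {i j : Fin d} {β : ℝ}
    (ω : TiltedRP.TiltedClassState d i j (unitaryFundamentalRep (Fin N) ℂ) β)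
    (x : Site d) (a : Fin d) (w : Word d) (hw : GaugeBoot.Word.endpointZd x w = x) :
    (∑ k ∈ (Finset.range w.length).filter (w.fwdOccZ a),
        (∫ U, (unitaryFundamentalRep (Fin N) ℂ (wordHolonomyZd U x (w.take k))).trace *
              (unitaryFundamentalRep (Fin N) ℂ (wordHolonomyZd U x (w.drop k))).trace ∂ω.μ).re / (N : ℝ) ^ 2) -
      (∑ k ∈ (Finset.range w.length).filter (w.bwdOccZ a),
        (∫ U, (unitaryFundamentalRep (Fin N) ℂ (wordHolonomyZd U x (w.take (k + 1)))).trace *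
              (unitaryFundamentalRep (Fin N) ℂ (wordHolonomyZd U x (w.drop (k + 1)))).trace ∂ω.μ).re /
          (N : ℝ) ^ 2) +
      β / (2 * N) * ∑ ν ∈ Finset.univ.erase a, ∑ ε : Bool,
        ((N : ℝ)⁻¹ * (∫ U, (unitaryFundamentalRep (Fin N) ℂ
            (wordHolonomyZd U x (w ++ plaqWord a ν ε))).trace ∂ω.μ).re -
          (N : ℝ)⁻¹ * (∫ U, (unitaryFundamentalRep (Fin N) ℂ
            (wordHolonomyZd U x (w ++ (plaqWord a ν ε).reverse))).trace ∂ω.μ).re) = 0 := by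
  haveI := ω.isProbabilityMeasure
  exact ω.haarShift.loopEquation_pairForm_uN x a w hw

/-- **The `U(N)` loop equations hold for every infinite-volume DLR state** `μ ∈ 𝒢(β)` on `ℤ^d`
(every real `β`, every `d`). [folklore] -/
theorem loopEquation_pairForm_uN_of_mem_ymGibbsMeasures {β : ℝ}
    {μ : Measure (LGConfig d (Matrix.unitaryGroup (Fin N) ℂ))}
    (hμ : μ ∈ ymGibbsMeasures (unitaryFundamentalRep (Fin N) ℂ) β) (x : Site d) (a : Fin d) (w : Word d)
    (hw : GaugeBoot.Word.endpointZd x w = x) :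
    (∑ k ∈ (Finset.range w.length).filter (w.fwdOccZ a),
        (∫ U, (unitaryFundamentalRep (Fin N) ℂ (wordHolonomyZd U x (w.take k))).trace *
              (unitaryFundamentalRep (Fin N) ℂ (wordHolonomyZd U x (w.drop k))).trace ∂μ).re / (N : ℝ) ^ 2) -
      (∑ k ∈ (Finset.range w.length).filter (w.bwdOccZ a),
        (∫ U, (unitaryFundamentalRep (Fin N) ℂ (wordHolonomyZd U x (w.take (k + 1)))).trace *
              (unitaryFundamentalRep (Fin N) ℂ (wordHolonomyZd U x (w.drop (k + 1)))).trace ∂μ).re /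
          (N : ℝ) ^ 2) +
      β / (2 * N) * ∑ ν ∈ Finset.univ.erase a, ∑ ε : Bool,
        ((N : ℝ)⁻¹ * (∫ U, (unitaryFundamentalRep (Fin N) ℂ
            (wordHolonomyZd U x (w ++ plaqWord a ν ε))).trace ∂μ).re -
          (N : ℝ)⁻¹ * (∫ U, (unitaryFundamentalRep (Fin N) ℂ
            (wordHolonomyZd U x (w ++ (plaqWord a ν ε).reverse))).trace ∂μ).re) = 0 := by
  haveI : SecondCountableTopology (Matrix (Fin N) (Fin N) ℂ) :=
    inferInstanceAs (SecondCountableTopology (Fin N → Fin N → ℂ))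
  haveI : SecondCountableTopology (Matrix.unitaryGroup (Fin N) ℂ) :=
    Topology.IsEmbedding.subtypeVal.secondCountableTopology
  have hG : IsGibbsMeasure (ymSpecification (unitaryFundamentalRep (Fin N) ℂ) β) μ := hμ
  haveI := hG.isProbabilityMeasure
  exact (isHaarShiftState_of_mem_ymGibbsMeasures (unitaryFundamentalRep (Fin N) ℂ)
    (continuous_unitaryFundamentalRep (Fin N) ℂ) hμ).loopEquation_pairForm_uN x a w hw

/-- **The `U(N)` loop equations hold for every infinite-volume limit point of the torus Wilson
states** (every real `β`, every `d`). [folklore] -/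
theorem loopEquation_pairForm_uN_of_mem_infiniteVolumeLimitPoints {β : ℝ}
    {μ : Measure (LGConfig d (Matrix.unitaryGroup (Fin N) ℂ))}
    (hμ : μ ∈ infiniteVolumeLimitPoints (d := d) (unitaryFundamentalRep (Fin N) ℂ) β) (x : Site d)
    (a : Fin d) (w : Word d) (hw : GaugeBoot.Word.endpointZd x w = x) :
    (∑ k ∈ (Finset.range w.length).filter (w.fwdOccZ a),
        (∫ U, (unitaryFundamentalRep (Fin N) ℂ (wordHolonomyZd U x (w.take k))).trace *
              (unitaryFundamentalRep (Fin N) ℂ (wordHolonomyZd U x (w.drop k))).trace ∂μ).re / (N : ℝ) ^ 2) -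
      (∑ k ∈ (Finset.range w.length).filter (w.bwdOccZ a),
        (∫ U, (unitaryFundamentalRep (Fin N) ℂ (wordHolonomyZd U x (w.take (k + 1)))).trace *
              (unitaryFundamentalRep (Fin N) ℂ (wordHolonomyZd U x (w.drop (k + 1)))).trace ∂μ).re /
          (N : ℝ) ^ 2) +
      β / (2 * N) * ∑ ν ∈ Finset.univ.erase a, ∑ ε : Bool,
        ((N : ℝ)⁻¹ * (∫ U, (unitaryFundamentalRep (Fin N) ℂ
            (wordHolonomyZd U x (w ++ plaqWord a ν ε))).trace ∂μ).re -
          (N : ℝ)⁻¹ * (∫ U, (unitaryFundamentalRep (Fin N) ℂ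
            (wordHolonomyZd U x (w ++ (plaqWord a ν ε).reverse))).trace ∂μ).re) = 0 := by
  haveI : SecondCountableTopology (Matrix (Fin N) (Fin N) ℂ) :=
    inferInstanceAs (SecondCountableTopology (Fin N → Fin N → ℂ))
  haveI : SecondCountableTopology (Matrix.unitaryGroup (Fin N) ℂ) :=
    Topology.IsEmbedding.subtypeVal.secondCountableTopology
  exact loopEquation_pairForm_uN_of_mem_ymGibbsMeasures
    (mem_ymGibbsMeasures_of_mem_infiniteVolumeLimitPoints_holds (unitaryFundamentalRep (Fin N) ℂ)
      (continuous_unitaryFundamentalRep (Fin N) ℂ) hμ) x a w hw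

end Unitary

end Summit.QuantumFields.GaugeBoot

end
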